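/-
COR-CM (cell pub-hodgecm2, stage 2 of the Hodge ladder) — count-neutral KERNEL CENSUS TRANSPORT, INTRINSIC FORM, type `(ℤ/2)³` (seat
prover-pub-hodgecm2-b23-g33-0, binder prover b23, gen 33; claim INT2-INTRINSIC, HOME/lit/LIT-STATUS.md 2026-08-21T18:02Z, addendum 19:2xZ;
sequel of `Census/OcticFaceTransportTriquadratic.lean` and `CorCM/FaceCensusGroupDictionary.lean`; companion of
`Census/OcticFaceTransportIntrinsicAbelian.lean`, whose §4 `FaceCensus.exists_mulEquiv_conj_zmod_two_cube` supplies the normalised isomorphism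
assumed here). Theorems only; no definition, no named fact, nothing asserted; seat b30's census dictionary (`enum`, `group_spec` of
`Census/OcticFaceSquaresTriquadratic`) is consumed BY NAME; `Interfaces.lean` (C1), every E term, B01 and `Transposition/*` are untouched.
HONEST FRAMING (COORDINATOR RULING — HODGE FRAMING CORRECTION, 2026-08-21T11:55:35Z): `HC_CM` is NOT proved, here or anywhere in the tree.
Every closing theorem below is CONDITIONAL on face-period witnesses (for ONE field, on the listed faces); no period is proved here.
T5 (coordinator ruling 15:33:56Z (3), lead staging l.4095): the DICTIONARY binders of `…_octicTriquadratic_aut` (`ε`, `hε`, `c`, `hc`,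
`ε c = Γ.conj`) are DISCHARGED here from an isomorphism `e : Gal(K/ℚ) ≃* Multiplicative (ZMod 2 × ZMod 2 × ZMod 2)` with `e⁻¹(1,0,0)` =
complex conjugation at `σ₀` — such an `e` exists for every field of the type (`FaceCensus.exists_mulEquiv_conj_zmod_two_cube`, companion
file); the face-reading binders are inhabited in the kernel (`exists_faceᵢ_of_mulEquiv`); the only remaining hypotheses are the period
witnesses on the three faces = instances of the crux (`FacePeriodExists` / B01-S), against which the tree has no `¬` theorem on the universe
of record — no contradiction derivable; checker: self (prover-pub-hodgecm2-b23-g33-0), 2026-08-21T19:15Z.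
-/
import Summits.HodgeConjecture.CorCM.FaceCensusGroupDictionary
import Summits.HodgeConjecture.CorCM.Census.OcticFaceTransportTriquadratic
import HarnessLib

/-!
# Galois CM fields with group `(ℤ/2)³`: field closure from an isomorphism with `ZMod 2 × ZMod 2 × ZMod 2` (intrinsic form)

The automorphism-form field-closure theorem `…_octicTriquadratic_aut` of the census transport takes an enumeration `ε : Aut(K) ≃ Fin 8`
multiplicative for seat b30's Cayley table, the conjugation automorphism `c` at `σ₀` and `ε c = Γ.conj` as hypotheses.  Here all of
it is derived from ONE isomorphism `e : Gal(K/ℚ) ≃* Multiplicative (ZMod 2 × ZMod 2 × ZMod 2)` under which `e⁻¹(1,0,0)` is complex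
conjugation at `σ₀` (every isomorphism can be so normalised: `FaceCensus.exists_mulEquiv_conj_zmod_two_cube`,
`Census/OcticFaceTransportIntrinsicAbelian.lean` §4): `ε := enum⁻¹ ∘ toAdd ∘ e` (`FaceCensus.exists_enum_of_groupEnum` over b30's
certified additive dictionary `group_spec`).  The THREE generating faces of b30's census then read as explicit group data: base type
`Φ₀ = {σ₀ ∘ h | e h ∈ {(0,0,0),(0,1,0),(0,0,1),(0,1,1)}}`, place representatives `σ₀` and `σ₀ ∘ e⁻¹(x)` for `x = (0,1,0), (0,0,1), (0,1,1)`.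
Such faces exist (`exists_faceᵢ_of_mulEquiv`), and ONE period witness per face on the universe of record gives the Hodge conjecture for
every complex abelian variety dominated by a product of CM abelian varieties with CM by subfields of `K` (`…_mulEquiv`).  Fields of
this type: `K = ℚ(√-d, √a, √b)` Galois with group `(ℤ/2)³` (e.g. `ℚ(ζ₂₄) = ℚ(i, √2, √3)`).  `HC_CM` is NOT proved and nothing here
produces a period.

References: [cite: Pohlmann1968, Thm. 1]; [cite: Milne1999LefschetzClasses, Thm. 3.2 and Cor. 4.5];
[cite: Shimura1998, §6.2 Theorem 3 and §6.1 Corollary of Theorem 2 (pp. 41–43)]; [cite: MumfordAV1970, §19 Thm. 1 and p. 169].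
-/

noncomputable section

open CategoryTheory NumberField NumberField.ComplexEmbedding
open Literature.AlgebraicGeometry Literature.AlgebraicGeometry.Motives Literature.AlgebraicGeometry.HodgeTheory
open Literature.AlgebraicGeometry.ComplexMultiplication Literature.AlgebraicGeometry.Milne1999
open Literature.NumberTheory.Automorphic
open Literature.NumberTheory.Automorphic.PicardCM
open Summit.HodgeConjecture.CorCM.Domination

namespace Summit.HodgeConjecture.CorCM.OcticFaceTransport.Triquadratic

open Summit.HodgeConjecture.CorCM.Census.FaceSquaresModel (mem)
open Summit.HodgeConjecture.CorCM.Census.OcticFaceSquaresTriquadratic (Γ enum group_spec)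

/-- **The dictionary from an isomorphism with `ZMod 2 × ZMod 2 × ZMod 2`, type `(ℤ/2)³`.**  `K` a Galois CM field,
`e : Gal(K/ℚ) ≃* Multiplicative (ZMod 2 × ZMod 2 × ZMod 2)` such that `e⁻¹(1,0,0)` induces complex conjugation at `σ₀` (such an `e` always exists: `FaceCensus.exists_mulEquiv_conj_zmod_two_cube`, companion file `Census/OcticFaceTransportIntrinsicAbelian.lean`).  Then there is an enumeration `ε : Aut(K) ≃ Fin 8`,
multiplicative for seat b30's Cayley table, reading `e` through b30's additive `enum` (`enum (ε h) = toAdd (e h)`), with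
`ε (e⁻¹ conj-element) = Γ.conj`. [folklore] -/
theorem exists_autEnum_of_mulEquiv (K : CMField) [IsGalois ℚ K] (e : ((K : Type) ≃ₐ[ℚ] (K : Type)) ≃* Multiplicative (ZMod 2 × ZMod 2 × ZMod 2)) :
    ∃ ε : ((K : Type) ≃ₐ[ℚ] (K : Type)) ≃ Fin 8,
      (∀ x y : ((K : Type) ≃ₐ[ℚ] (K : Type)), ε (x * y) = Γ.mul (ε x) (ε y)) ∧ (∀ h : ((K : Type) ≃ₐ[ℚ] (K : Type)), enum (ε h) = Multiplicative.toAdd (e h)) ∧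
      (∀ (h : ((K : Type) ≃ₐ[ℚ] (K : Type))) (i : Fin 8), Multiplicative.toAdd (e h) = enum i → ε h = i) ∧
      ε (e.symm (Multiplicative.ofAdd ((1 : ZMod 2), (0 : ZMod 2), (0 : ZMod 2)))) = Γ.conj := by
  obtain ⟨ε, hε, hread⟩ := FaceCensus.exists_enum_of_groupEnum Γ (· + ·) enum group_spec.2.1 group_spec.2.2.1
    (by simp) (fun h => Multiplicative.toAdd (e h)) (Multiplicative.toAdd.bijective.comp e.bijective)
    (fun x y => by rw [map_mul, toAdd_mul])
  refine ⟨ε, hε, hread, fun h i hh => group_spec.2.2.1 ((hread h).trans hh), group_spec.2.2.1 ?_⟩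
  rw [hread, MulEquiv.apply_symm_apply, toAdd_ofAdd, group_spec.2.2.2]

/-- The common base type of the generating representatives, code `85`, read in `ZMod 2 × ZMod 2 × ZMod 2`. [folklore] -/
theorem mem_85_iff_enum : ∀ i : Fin 8, mem i 85 = true ↔ enum i ∈ ({((0 : ZMod 2), (0 : ZMod 2), (0 : ZMod 2)), ((0 : ZMod 2), (1 : ZMod 2), (0 : ZMod 2)), ((0 : ZMod 2), (0 : ZMod 2), (1 : ZMod 2)), ((0 : ZMod 2), (1 : ZMod 2), (1 : ZMod 2))} : Finset (ZMod 2 × ZMod 2 × ZMod 2)) := by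
  decide

/-- **Non-vacuity, type `(ℤ/2)³`, face 1.**  For `K`, `e`, `σ₀` as in the closing theorem there is a rank-four face
`(Φ₀; σ₀, σ₀ ∘ e⁻¹(0,1,0))`: base type `Φ₀` with `σ₀ ∘ h ∈ Φ₀ ↔ e h ∈ {(0,0,0),(0,1,0),(0,0,1),(0,1,1)}`, place representatives `σ₀` and `σ₀ ∘ e⁻¹((0), (1), (0))`.
[folklore] -/
theorem exists_face₁_of_mulEquiv (K : CMField) [IsGalois ℚ K] (e : ((K : Type) ≃ₐ[ℚ] (K : Type)) ≃* Multiplicative (ZMod 2 × ZMod 2 × ZMod 2)) (σ₀ : (K : Type) →+* ℂ)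
    (hconj : σ₀.comp ((e.symm (Multiplicative.ofAdd ((1 : ZMod 2), (0 : ZMod 2), (0 : ZMod 2))) : ((K : Type) ≃ₐ[ℚ] (K : Type))) : (K : Type) →+* (K : Type)) = conjugate σ₀) :
    ∃ R : Face K, (∀ h : ((K : Type) ≃ₐ[ℚ] (K : Type)), σ₀.comp (h : (K : Type) →+* (K : Type)) ∈ R.Φ.1 ↔ Multiplicative.toAdd (e h) ∈ ({((0 : ZMod 2), (0 : ZMod 2), (0 : ZMod 2)), ((0 : ZMod 2), (1 : ZMod 2), (0 : ZMod 2)), ((0 : ZMod 2), (0 : ZMod 2), (1 : ZMod 2)), ((0 : ZMod 2), (1 : ZMod 2), (1 : ZMod 2))} : Finset (ZMod 2 × ZMod 2 × ZMod 2))) ∧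
      R.p = σ₀ ∧ R.p' = σ₀.comp ((e.symm (Multiplicative.ofAdd ((0 : ZMod 2), (1 : ZMod 2), (0 : ZMod 2))) : ((K : Type) ≃ₐ[ℚ] (K : Type))) : (K : Type) →+* (K : Type)) := by
  obtain ⟨ε, hε, hread, hidx, hεc⟩ := exists_autEnum_of_mulEquiv K e
  obtain ⟨e', hmul, he⟩ := FaceCensus.exists_enum_of_autEnum Γ σ₀ ε hε
  have hconj' : e' conjT = Γ.conj := by rw [FaceCensus.conjT_eq_translate σ₀, ← hconj, he, hεc]
  obtain ⟨R₀, hT₀, -, -⟩ := FaceCensus.exists_face_reads Γ e' hmul hconj' σ₀ (r := (85, 3, 12)) (by decide +kernel)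
  have hq : ε (e.symm (Multiplicative.ofAdd ((0 : ZMod 2), (1 : ZMod 2), (0 : ZMod 2)))) = 2 :=
    hidx _ _ (by rw [MulEquiv.apply_symm_apply, toAdd_ofAdd]; decide)
  have h1 : ε 1 = 0 := hidx _ _ (by rw [map_one, toAdd_one]; decide)
  have hne' : InfinitePlace.mk (σ₀.comp ((1 : ((K : Type) ≃ₐ[ℚ] (K : Type))) : (K : Type) →+* (K : Type))) ≠
      InfinitePlace.mk (σ₀.comp ((e.symm (Multiplicative.ofAdd ((0 : ZMod 2), (1 : ZMod 2), (0 : ZMod 2))) : ((K : Type) ≃ₐ[ℚ] (K : Type))) : (K : Type) →+* (K : Type))) := by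
    rw [Ne, FaceCensus.mk_comp_eq_mk_comp_iff σ₀ hconj]
    rintro (h | h)
    · have := congrArg ε h; rw [h1, hq] at this; exact absurd this (by decide)
    · have := congrArg ε h; rw [mul_one, hεc, hq] at this; exact absurd this (by decide)
  have hne : InfinitePlace.mk σ₀ ≠ InfinitePlace.mk (σ₀.comp ((e.symm (Multiplicative.ofAdd ((0 : ZMod 2), (1 : ZMod 2), (0 : ZMod 2))) : ((K : Type) ≃ₐ[ℚ] (K : Type))) : (K : Type) →+* (K : Type))) := by
    rwa [FaceCensus.comp_coe_one] at hne'
  refine ⟨⟨R₀.Φ, _, _, hne⟩, fun h => ?_, rfl, rfl⟩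
  have hk := hT₀.2 (e' (translate σ₀ (σ₀.comp (h : (K : Type) →+* (K : Type)))))
  rw [e'.symm_apply_apply, mem_pullType, translate_apply_self, he] at hk
  rw [← hread h]
  exact hk.symm.trans (mem_85_iff_enum (ε h))

/-- **Non-vacuity, type `(ℤ/2)³`, face 2.**  For `K`, `e`, `σ₀` as in the closing theorem there is a rank-four face
`(Φ₀; σ₀, σ₀ ∘ e⁻¹(0,0,1))`: base type `Φ₀` with `σ₀ ∘ h ∈ Φ₀ ↔ e h ∈ {(0,0,0),(0,1,0),(0,0,1),(0,1,1)}`, place representatives `σ₀` and `σ₀ ∘ e⁻¹((0), (0), (1))`.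
[folklore] -/
theorem exists_face₂_of_mulEquiv (K : CMField) [IsGalois ℚ K] (e : ((K : Type) ≃ₐ[ℚ] (K : Type)) ≃* Multiplicative (ZMod 2 × ZMod 2 × ZMod 2)) (σ₀ : (K : Type) →+* ℂ)
    (hconj : σ₀.comp ((e.symm (Multiplicative.ofAdd ((1 : ZMod 2), (0 : ZMod 2), (0 : ZMod 2))) : ((K : Type) ≃ₐ[ℚ] (K : Type))) : (K : Type) →+* (K : Type)) = conjugate σ₀) :
    ∃ R : Face K, (∀ h : ((K : Type) ≃ₐ[ℚ] (K : Type)), σ₀.comp (h : (K : Type) →+* (K : Type)) ∈ R.Φ.1 ↔ Multiplicative.toAdd (e h) ∈ ({((0 : ZMod 2), (0 : ZMod 2), (0 : ZMod 2)), ((0 : ZMod 2), (1 : ZMod 2), (0 : ZMod 2)), ((0 : ZMod 2), (0 : ZMod 2), (1 : ZMod 2)), ((0 : ZMod 2), (1 : ZMod 2), (1 : ZMod 2))} : Finset (ZMod 2 × ZMod 2 × ZMod 2))) ∧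
      R.p = σ₀ ∧ R.p' = σ₀.comp ((e.symm (Multiplicative.ofAdd ((0 : ZMod 2), (0 : ZMod 2), (1 : ZMod 2))) : ((K : Type) ≃ₐ[ℚ] (K : Type))) : (K : Type) →+* (K : Type)) := by
  obtain ⟨ε, hε, hread, hidx, hεc⟩ := exists_autEnum_of_mulEquiv K e
  obtain ⟨e', hmul, he⟩ := FaceCensus.exists_enum_of_autEnum Γ σ₀ ε hε
  have hconj' : e' conjT = Γ.conj := by rw [FaceCensus.conjT_eq_translate σ₀, ← hconj, he, hεc]
  obtain ⟨R₀, hT₀, -, -⟩ := FaceCensus.exists_face_reads Γ e' hmul hconj' σ₀ (r := (85, 3, 48)) (by decide +kernel)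
  have hq : ε (e.symm (Multiplicative.ofAdd ((0 : ZMod 2), (0 : ZMod 2), (1 : ZMod 2)))) = 4 :=
    hidx _ _ (by rw [MulEquiv.apply_symm_apply, toAdd_ofAdd]; decide)
  have h1 : ε 1 = 0 := hidx _ _ (by rw [map_one, toAdd_one]; decide)
  have hne' : InfinitePlace.mk (σ₀.comp ((1 : ((K : Type) ≃ₐ[ℚ] (K : Type))) : (K : Type) →+* (K : Type))) ≠
      InfinitePlace.mk (σ₀.comp ((e.symm (Multiplicative.ofAdd ((0 : ZMod 2), (0 : ZMod 2), (1 : ZMod 2))) : ((K : Type) ≃ₐ[ℚ] (K : Type))) : (K : Type) →+* (K : Type))) := by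
    rw [Ne, FaceCensus.mk_comp_eq_mk_comp_iff σ₀ hconj]
    rintro (h | h)
    · have := congrArg ε h; rw [h1, hq] at this; exact absurd this (by decide)
    · have := congrArg ε h; rw [mul_one, hεc, hq] at this; exact absurd this (by decide)
  have hne : InfinitePlace.mk σ₀ ≠ InfinitePlace.mk (σ₀.comp ((e.symm (Multiplicative.ofAdd ((0 : ZMod 2), (0 : ZMod 2), (1 : ZMod 2))) : ((K : Type) ≃ₐ[ℚ] (K : Type))) : (K : Type) →+* (K : Type))) := by
    rwa [FaceCensus.comp_coe_one] at hne'
  refine ⟨⟨R₀.Φ, _, _, hne⟩, fun h => ?_, rfl, rfl⟩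
  have hk := hT₀.2 (e' (translate σ₀ (σ₀.comp (h : (K : Type) →+* (K : Type)))))
  rw [e'.symm_apply_apply, mem_pullType, translate_apply_self, he] at hk
  rw [← hread h]
  exact hk.symm.trans (mem_85_iff_enum (ε h))

/-- **Non-vacuity, type `(ℤ/2)³`, face 3.**  For `K`, `e`, `σ₀` as in the closing theorem there is a rank-four face
`(Φ₀; σ₀, σ₀ ∘ e⁻¹(0,1,1))`: base type `Φ₀` with `σ₀ ∘ h ∈ Φ₀ ↔ e h ∈ {(0,0,0),(0,1,0),(0,0,1),(0,1,1)}`, place representatives `σ₀` and `σ₀ ∘ e⁻¹((0), (1), (1))`.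
[folklore] -/
theorem exists_face₃_of_mulEquiv (K : CMField) [IsGalois ℚ K] (e : ((K : Type) ≃ₐ[ℚ] (K : Type)) ≃* Multiplicative (ZMod 2 × ZMod 2 × ZMod 2)) (σ₀ : (K : Type) →+* ℂ)
    (hconj : σ₀.comp ((e.symm (Multiplicative.ofAdd ((1 : ZMod 2), (0 : ZMod 2), (0 : ZMod 2))) : ((K : Type) ≃ₐ[ℚ] (K : Type))) : (K : Type) →+* (K : Type)) = conjugate σ₀) :
    ∃ R : Face K, (∀ h : ((K : Type) ≃ₐ[ℚ] (K : Type)), σ₀.comp (h : (K : Type) →+* (K : Type)) ∈ R.Φ.1 ↔ Multiplicative.toAdd (e h) ∈ ({((0 : ZMod 2), (0 : ZMod 2), (0 : ZMod 2)), ((0 : ZMod 2), (1 : ZMod 2), (0 : ZMod 2)), ((0 : ZMod 2), (0 : ZMod 2), (1 : ZMod 2)), ((0 : ZMod 2), (1 : ZMod 2), (1 : ZMod 2))} : Finset (ZMod 2 × ZMod 2 × ZMod 2))) ∧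
      R.p = σ₀ ∧ R.p' = σ₀.comp ((e.symm (Multiplicative.ofAdd ((0 : ZMod 2), (1 : ZMod 2), (1 : ZMod 2))) : ((K : Type) ≃ₐ[ℚ] (K : Type))) : (K : Type) →+* (K : Type)) := by
  obtain ⟨ε, hε, hread, hidx, hεc⟩ := exists_autEnum_of_mulEquiv K e
  obtain ⟨e', hmul, he⟩ := FaceCensus.exists_enum_of_autEnum Γ σ₀ ε hε
  have hconj' : e' conjT = Γ.conj := by rw [FaceCensus.conjT_eq_translate σ₀, ← hconj, he, hεc]
  obtain ⟨R₀, hT₀, -, -⟩ := FaceCensus.exists_face_reads Γ e' hmul hconj' σ₀ (r := (85, 3, 192)) (by decide +kernel)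
  have hq : ε (e.symm (Multiplicative.ofAdd ((0 : ZMod 2), (1 : ZMod 2), (1 : ZMod 2)))) = 6 :=
    hidx _ _ (by rw [MulEquiv.apply_symm_apply, toAdd_ofAdd]; decide)
  have h1 : ε 1 = 0 := hidx _ _ (by rw [map_one, toAdd_one]; decide)
  have hne' : InfinitePlace.mk (σ₀.comp ((1 : ((K : Type) ≃ₐ[ℚ] (K : Type))) : (K : Type) →+* (K : Type))) ≠
      InfinitePlace.mk (σ₀.comp ((e.symm (Multiplicative.ofAdd ((0 : ZMod 2), (1 : ZMod 2), (1 : ZMod 2))) : ((K : Type) ≃ₐ[ℚ] (K : Type))) : (K : Type) →+* (K : Type))) := by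
    rw [Ne, FaceCensus.mk_comp_eq_mk_comp_iff σ₀ hconj]
    rintro (h | h)
    · have := congrArg ε h; rw [h1, hq] at this; exact absurd this (by decide)
    · have := congrArg ε h; rw [mul_one, hεc, hq] at this; exact absurd this (by decide)
  have hne : InfinitePlace.mk σ₀ ≠ InfinitePlace.mk (σ₀.comp ((e.symm (Multiplicative.ofAdd ((0 : ZMod 2), (1 : ZMod 2), (1 : ZMod 2))) : ((K : Type) ≃ₐ[ℚ] (K : Type))) : (K : Type) →+* (K : Type))) := by
    rwa [FaceCensus.comp_coe_one] at hne'
  refine ⟨⟨R₀.Φ, _, _, hne⟩, fun h => ?_, rfl, rfl⟩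
  have hk := hT₀.2 (e' (translate σ₀ (σ₀.comp (h : (K : Type) →+* (K : Type)))))
  rw [e'.symm_apply_apply, mem_pullType, translate_apply_self, he] at hk
  rw [← hread h]
  exact hk.symm.trans (mem_85_iff_enum (ε h))

/-- **FIELD CLOSURE FROM `Gal(K/ℚ) ≃* Multiplicative (ZMod 2 × ZMod 2 × ZMod 2)`, type `(ℤ/2)³` — CLOSED, headline.**  `K` a Galois CM
field with an isomorphism `e : Gal(K/ℚ) ≃* Multiplicative (ZMod 2 × ZMod 2 × ZMod 2)` (so `[K:ℚ] = 8`) under which `e⁻¹(1,0,0)` induces complex conjugation at `σ₀` (such an `e` always exists: `FaceCensus.exists_mulEquiv_conj_zmod_two_cube`, companion file `Census/OcticFaceTransportIntrinsicAbelian.lean`); `σ₀` a base embedding;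
`Φ₀` the CM type with `σ₀ ∘ h ∈ Φ₀ ↔ e h ∈ {(0,0,0),(0,1,0),(0,0,1),(0,1,1)}`; the THREE faces `R₁ = (Φ₀; σ₀, σ₀ ∘ e⁻¹(0,1,0))`, `R₂ = (Φ₀; σ₀, σ₀ ∘ e⁻¹(0,0,1))`, `R₃ = (Φ₀; σ₀, σ₀ ∘ e⁻¹(0,1,1))`
(they exist: `exists_face₁_of_mulEquiv`, `exists_face₂_of_mulEquiv`, `exists_face₃_of_mulEquiv`).  ONE period witness for each on the universe of record implies the Hodge conjecture, in every
codimension, for every complex abelian variety dominated by a finite product of abelian varieties realising CM types of CM fields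
embeddable in `K`.  No enumeration or table hypothesis is left (`exists_autEnum_of_mulEquiv`).  (FRAMING: conditional on these face
periods; `HC_CM` is NOT proved.) [cite: Shimura1998, §6.2 Theorem 3 and §6.1 Corollary of Theorem 2 (pp. 41–43)]
[cite: Pohlmann1968, Thm. 1] [cite: Milne1999LefschetzClasses, Thm. 3.2 and Cor. 4.5] [cite: MumfordAV1970, §19 Thm. 1 and p. 169] -/
theorem hodgeConjectureFor_of_avDominatedBy_isProductOf_of_facePeriod_octicTriquadratic_mulEquiv (K : CMField) [IsGalois ℚ K]
    (e : ((K : Type) ≃ₐ[ℚ] (K : Type)) ≃* Multiplicative (ZMod 2 × ZMod 2 × ZMod 2)) (σ₀ : (K : Type) →+* ℂ)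
    (hconj : σ₀.comp ((e.symm (Multiplicative.ofAdd ((1 : ZMod 2), (0 : ZMod 2), (0 : ZMod 2))) : ((K : Type) ≃ₐ[ℚ] (K : Type))) : (K : Type) →+* (K : Type)) = conjugate σ₀)
    (R₁ R₂ R₃ : Face K)
    (hΦ₁ : ∀ h : ((K : Type) ≃ₐ[ℚ] (K : Type)), σ₀.comp (h : (K : Type) →+* (K : Type)) ∈ R₁.Φ.1 ↔ Multiplicative.toAdd (e h) ∈ ({((0 : ZMod 2), (0 : ZMod 2), (0 : ZMod 2)), ((0 : ZMod 2), (1 : ZMod 2), (0 : ZMod 2)), ((0 : ZMod 2), (0 : ZMod 2), (1 : ZMod 2)), ((0 : ZMod 2), (1 : ZMod 2), (1 : ZMod 2))} : Finset (ZMod 2 × ZMod 2 × ZMod 2)))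
    (hp₁ : R₁.p = σ₀) (hq₁ : R₁.p' = σ₀.comp ((e.symm (Multiplicative.ofAdd ((0 : ZMod 2), (1 : ZMod 2), (0 : ZMod 2))) : ((K : Type) ≃ₐ[ℚ] (K : Type))) : (K : Type) →+* (K : Type)))
    (hΦ₂ : ∀ h : ((K : Type) ≃ₐ[ℚ] (K : Type)), σ₀.comp (h : (K : Type) →+* (K : Type)) ∈ R₂.Φ.1 ↔ Multiplicative.toAdd (e h) ∈ ({((0 : ZMod 2), (0 : ZMod 2), (0 : ZMod 2)), ((0 : ZMod 2), (1 : ZMod 2), (0 : ZMod 2)), ((0 : ZMod 2), (0 : ZMod 2), (1 : ZMod 2)), ((0 : ZMod 2), (1 : ZMod 2), (1 : ZMod 2))} : Finset (ZMod 2 × ZMod 2 × ZMod 2)))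
    (hp₂ : R₂.p = σ₀) (hq₂ : R₂.p' = σ₀.comp ((e.symm (Multiplicative.ofAdd ((0 : ZMod 2), (0 : ZMod 2), (1 : ZMod 2))) : ((K : Type) ≃ₐ[ℚ] (K : Type))) : (K : Type) →+* (K : Type)))
    (hΦ₃ : ∀ h : ((K : Type) ≃ₐ[ℚ] (K : Type)), σ₀.comp (h : (K : Type) →+* (K : Type)) ∈ R₃.Φ.1 ↔ Multiplicative.toAdd (e h) ∈ ({((0 : ZMod 2), (0 : ZMod 2), (0 : ZMod 2)), ((0 : ZMod 2), (1 : ZMod 2), (0 : ZMod 2)), ((0 : ZMod 2), (0 : ZMod 2), (1 : ZMod 2)), ((0 : ZMod 2), (1 : ZMod 2), (1 : ZMod 2))} : Finset (ZMod 2 × ZMod 2 × ZMod 2)))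
    (hp₃ : R₃.p = σ₀) (hq₃ : R₃.p' = σ₀.comp ((e.symm (Multiplicative.ofAdd ((0 : ZMod 2), (1 : ZMod 2), (1 : ZMod 2))) : ((K : Type) ≃ₐ[ℚ] (K : Type))) : (K : Type) →+* (K : Type)))
    (h₁ : ∃ ι₁ : K →+* ℂ, R₁.Admissible ι₁ ∧ ∃ (V : HermSpace3 K ι₁) (σ : K →+* ℂ),
      (Model.picardCMUniverse exists_isReal_hodgeModel_holds hodgePQ_independent_of_hodgeModel_holds
        BallQuotient.ballQuotientUniformised_holds cmAbelianVarietyRealised_holds).PeriodNV ι₁ V K R₁.psi σ)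
    (h₂ : ∃ ι₁ : K →+* ℂ, R₂.Admissible ι₁ ∧ ∃ (V : HermSpace3 K ι₁) (σ : K →+* ℂ),
      (Model.picardCMUniverse exists_isReal_hodgeModel_holds hodgePQ_independent_of_hodgeModel_holds
        BallQuotient.ballQuotientUniformised_holds cmAbelianVarietyRealised_holds).PeriodNV ι₁ V K R₂.psi σ)
    (h₃ : ∃ ι₁ : K →+* ℂ, R₃.Admissible ι₁ ∧ ∃ (V : HermSpace3 K ι₁) (σ : K →+* ℂ),
      (Model.picardCMUniverse exists_isReal_hodgeModel_holds hodgePQ_independent_of_hodgeModel_holds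
        BallQuotient.ballQuotientUniformised_holds cmAbelianVarietyRealised_holds).PeriodNV ι₁ V K R₃.psi σ)
    {P A : AbelianVariety ℂ} (hP : AbelianVariety.IsProductOf (fun B : AbelianVariety ℂ =>
      ∃ (E : Type) (_ : Field E) (_ : NumberField E) (_ : IsCMField E) (_ : E →+* (K : Type)) (Φ : CMType E)
        (ι : 𝓞 E →+* End B) (θ : E →+* Module.End ℂ (complexBetti B.X 1)),
        IsCMTypeRealisation Φ B ι θ) P)
    (hA : AVDominatedBy A P) : HodgeConjectureFor A.dim A.X := by
  obtain ⟨ε, hε, hread, hidx, hεc⟩ := exists_autEnum_of_mulEquiv K e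
  refine hodgeConjectureFor_of_avDominatedBy_isProductOf_of_facePeriod_octicTriquadratic_aut K σ₀ ε hε _ hconj hεc R₁ R₂ R₃
    1 (e.symm (Multiplicative.ofAdd ((0 : ZMod 2), (1 : ZMod 2), (0 : ZMod 2)))) 1 (e.symm (Multiplicative.ofAdd ((0 : ZMod 2), (0 : ZMod 2), (1 : ZMod 2)))) 1 (e.symm (Multiplicative.ofAdd ((0 : ZMod 2), (1 : ZMod 2), (1 : ZMod 2))))
    ?_ ?_ ?_ ?_ ?_ ?_ ?_ ?_ ?_ ?_ ?_ ?_ ?_ ?_ ?_ h₁ h₂ h₃ hP hA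
  · intro h
    rw [hΦ₁, ← hread h]
    exact (mem_85_iff_enum (ε h)).symm
  · rw [hp₁, FaceCensus.comp_coe_one]
  · rw [hidx 1 0 (by rw [map_one, toAdd_one]; decide)]; decide
  · exact hq₁
  · rw [hidx _ 2 (by rw [MulEquiv.apply_symm_apply, toAdd_ofAdd]; decide)]; decide
  · intro h
    rw [hΦ₂, ← hread h]
    exact (mem_85_iff_enum (ε h)).symm
  · rw [hp₂, FaceCensus.comp_coe_one]
  · rw [hidx 1 0 (by rw [map_one, toAdd_one]; decide)]; decide
  · exact hq₂
  · rw [hidx _ 4 (by rw [MulEquiv.apply_symm_apply, toAdd_ofAdd]; decide)]; decide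
  · intro h
    rw [hΦ₃, ← hread h]
    exact (mem_85_iff_enum (ε h)).symm
  · rw [hp₃, FaceCensus.comp_coe_one]
  · rw [hidx 1 0 (by rw [map_one, toAdd_one]; decide)]; decide
  · exact hq₃
  · rw [hidx _ 6 (by rw [MulEquiv.apply_symm_apply, toAdd_ofAdd]; decide)]; decide

end Summit.HodgeConjecture.CorCM.OcticFaceTransport.Triquadratic

end
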